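import Mathlib
import Summits.AnomalousDissipation.AnomalousDissipation.Theorems.SoloBlindFluxState

/-!
# The band-centre zero mode of the streak chain and the real/imaginary split of the flux state (solo-blind kernel #205)

On the streak cos-chain (sites `m ≥ 0`, hopping `(H ψ)₀ = √2 ψ₁`, `(H ψ)₁ = √2 ψ₀ + ψ₂`,
`(H ψ)ₘ = ψₘ₋₁ + ψₘ₊₁` for `m ≥ 2`) the sequence `z = (1, 0, -√2, 0, √2, 0, -√2, …)`
(`z_{2j} = (-1)^j √2` for `j ≥ 1`, odd sites zero) is annihilated by `H`: it is the *band-centre zero mode*.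
The sequence `w = (0, 1, 0, -2, 0, 2, 0, -2, …)` (`w_{2j+1} = 2(-1)^j` for `j ≥ 1`, even sites zero)
solves the source equation `H w = √2 e₀ - e₂`.  The outgoing flux state of kernel #202 is exactly
`fluxState α = -α (w + i √2 z)`: a real particular solution plus `i` times the zero mode.
The zero mode has `z₁ = 0` — it is invisible to the streak read-out at site 1 (channel II) — and
feeds the roll chain only through its even sites; this is the slow component of channel I in LEMMA R
(architecture A5, blueprint §2 F3).
-/

namespace Summit.AnomalousDissipation.AnomalousDissipation.Theorems

open Complex

/-- The half-chain hopping operator with the `√2` first bond, acting on complex sequences. -/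
noncomputable def streakHop (ψ : ℕ → ℂ) : ℕ → ℂ := fun m =>
  if m = 0 then (Real.sqrt 2 : ℂ) * ψ 1
  else if m = 1 then (Real.sqrt 2 : ℂ) * ψ 0 + ψ 2
  else ψ (m - 1) + ψ (m + 1)

/-- The band-centre zero mode: `z₀ = 1`, `z_{2j} = (-1)^j √2` (`j ≥ 1`), `z_{odd} = 0`. -/
noncomputable def zeroMode (m : ℕ) : ℂ :=
  if m = 0 then 1 else if m % 2 = 1 then 0 else (-1) ^ (m / 2) * (Real.sqrt 2 : ℂ)

/-- The real particular solution of the source equation: `w₁ = 1`, `w_{2j+1} = 2(-1)^j` (`j ≥ 1`), `w_{even} = 0`. -/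
noncomputable def sourceMode (m : ℕ) : ℂ :=
  if m % 2 = 0 then 0 else if m = 1 then 1 else 2 * (-1) ^ (m / 2)

/-- Useful arithmetic: `√2 · √2 = 2` in `ℂ`. -/
private theorem sqrt2_mul_sqrt2 : (Real.sqrt 2 : ℂ) * (Real.sqrt 2 : ℂ) = 2 := by
  rw [← Complex.ofReal_mul, Real.mul_self_sqrt (by norm_num : (0:ℝ) ≤ 2)]; norm_num

/-- `z` is annihilated by the hopping operator at site 0. -/
theorem streakHop_zeroMode_zero : streakHop zeroMode 0 = 0 := by
  simp [streakHop, zeroMode]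

/-- `z` is annihilated at site 1: `√2 z₀ + z₂ = √2 - √2 = 0`. -/
theorem streakHop_zeroMode_one : streakHop zeroMode 1 = 0 := by
  simp [streakHop, zeroMode]

/-- `z` is annihilated at every site `m ≥ 2`. -/
theorem streakHop_zeroMode_add_two (m : ℕ) : streakHop zeroMode (m + 2) = 0 := by
  simp only [streakHop, zeroMode, show m + 2 ≠ 0 by omega, show m + 2 ≠ 1 by omega, if_false,
    show m + 2 - 1 = m + 1 by omega, show m + 2 + 1 = m + 3 by omega, show m + 1 ≠ 0 by omega,
    show m + 3 ≠ 0 by omega]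
  rcases Nat.even_or_odd m with ⟨k, rfl⟩ | ⟨k, rfl⟩
  · -- m = 2k: sites m+1, m+3 odd → both zero
    simp [show (k + k + 1) % 2 = 1 by omega, show (k + k + 3) % 2 = 1 by omega]
  · -- m = 2k+1: sites 2k+2 and 2k+4 even, signs (-1)^(k+1) and (-1)^(k+2) cancel
    simp only [show (2 * k + 1 + 1) % 2 ≠ 1 by omega, show (2 * k + 1 + 3) % 2 ≠ 1 by omega, if_false,
      show (2 * k + 1 + 1) / 2 = k + 1 by omega, show (2 * k + 1 + 3) / 2 = k + 2 by omega]
    ring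

/-- The zero mode is a zero mode: `H z = 0`. -/
theorem streakHop_zeroMode : streakHop zeroMode = 0 := by
  funext m
  rcases m with _ | m
  · exact streakHop_zeroMode_zero
  rcases m with _ | m
  · exact streakHop_zeroMode_one
  · simpa using streakHop_zeroMode_add_two m

/-- `w` solves the source equation at site 0: `(H w)₀ = √2 w₁ = √2`. -/
theorem streakHop_sourceMode_zero : streakHop sourceMode 0 = (Real.sqrt 2 : ℂ) := by
  simp [streakHop, sourceMode]

/-- … at site 1: `(H w)₁ = √2 w₀ + w₂ = 0`. -/
theorem streakHop_sourceMode_one : streakHop sourceMode 1 = 0 := by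
  simp [streakHop, sourceMode]

/-- … at site 2: `(H w)₂ = w₁ + w₃ = 1 - 2 = -1`. -/
theorem streakHop_sourceMode_two : streakHop sourceMode 2 = -1 := by
  simp [streakHop, sourceMode]; norm_num

/-- … and at every site `m ≥ 3`: `(H w)ₘ = 0`. -/
theorem streakHop_sourceMode_add_three (m : ℕ) : streakHop sourceMode (m + 3) = 0 := by
  simp only [streakHop, sourceMode, show m + 3 ≠ 0 by omega, show m + 3 ≠ 1 by omega, if_false,
    show m + 3 - 1 = m + 2 by omega, show m + 3 + 1 = m + 4 by omega]
  rcases Nat.even_or_odd m with ⟨k, rfl⟩ | ⟨k, rfl⟩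
  · -- m = 2k: sites 2k+2, 2k+4 even → zero
    simp [show (k + k + 2) % 2 = 0 by omega, show (k + k + 4) % 2 = 0 by omega]
  · -- m = 2k+1: sites 2k+3, 2k+5 odd, ≠ 1, signs (-1)^(k+1), (-1)^(k+2)
    simp only [show (2 * k + 1 + 2) % 2 ≠ 0 by omega, show (2 * k + 1 + 4) % 2 ≠ 0 by omega,
      show 2 * k + 1 + 2 ≠ 1 by omega, show 2 * k + 1 + 4 ≠ 1 by omega, if_false,
      show (2 * k + 1 + 2) / 2 = k + 1 by omega, show (2 * k + 1 + 4) / 2 = k + 2 by omega]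
    ring

/-- The flux state of kernel #202 is `-α (w + i√2 z)`: real particular solution plus `i` times the zero mode. -/
theorem fluxState_eq_sourceMode_add_zeroMode (α : ℝ) (m : ℕ) :
    fluxState α m = -(α : ℂ) * (sourceMode m + I * (Real.sqrt 2 : ℂ) * zeroMode m) := by
  rcases m with _ | m
  · simp [fluxState, sourceMode, zeroMode]; ring
  rcases m with _ | m
  · simp [fluxState, sourceMode, zeroMode]
  · -- m + 2 ≥ 2
    simp only [fluxState, sourceMode, zeroMode, show m + 2 ≠ 0 by omega, show m + 2 ≠ 1 by omega, if_false]
    rcases Nat.even_or_odd m with ⟨k, rfl⟩ | ⟨k, rfl⟩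
    · -- m + 2 = 2k + 2 even: (-I)^(2k+2) = (-1)^(k+1)
      simp only [show (k + k + 2) % 2 = 0 by omega, if_true, show (k + k + 2) / 2 = k + 1 by omega]
      have : (-I) ^ (k + k + 2) = (-1) ^ (k + 1) := by
        rw [show k + k + 2 = 2 * (k + 1) by ring, pow_mul, neg_sq, I_sq]
      rw [this]
      simp only [Nat.reduceEqDiff, ↓reduceIte]
      have h2 := sqrt2_mul_sqrt2
      linear_combination (α:ℂ) * I * (-1) ^ (k + 1) * h2
    · -- m + 2 = 2k + 3 odd: (-I)^(2k+3) = (-1)^(k+1) * (-I)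
      simp only [show (2 * k + 1 + 2) % 2 = 1 by omega, if_true, show (2 * k + 1 + 2) / 2 = k + 1 by omega]
      have : (-I) ^ (2 * k + 1 + 2) = (-1) ^ (k + 1) * (-I) := by
        rw [show 2 * k + 1 + 2 = 2 * (k + 1) + 1 by ring, pow_succ, pow_mul, neg_sq, I_sq]
      rw [this]
      simp only [Nat.reduceEqDiff, ↓reduceIte]
      have hI : I * I = -1 := I_mul_I
      linear_combination (2 * (α:ℂ) * (-1) ^ (k + 1)) * hI

end Summit.AnomalousDissipation.AnomalousDissipation.Theorems
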